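import Summits.Ventures.HodgeRepro2.T6N41PlaceSplitHyp
import Summits.Ventures.HodgeRepro2.T6N41PlaceInertMain

/-!
# T6N41PlaceSplitMain — the Satake identity at the split places, and the placement modulo (A″κ) (Tier 6, M2; proof lane; owner t6-p4)

`π_eq_psF`: at a split `v ∉ S`, `π_v = I(μ₂, β′_v⁻¹ μ₁ μ₂)` — the datum's theta lift is Mínguez's lift of
`β′_v μ₁⁻¹` twisted by `μ₂ ∘ det` (`Θ_eq`), Mínguez's Théorème 1 (2) makes that lift the Langlands quotient of
`1 × (β′_v μ₁⁻¹)⁻¹` (the display `Minguez2008_Thm1_2_LQ`), Bump's Theorem 4.5.1 makes that Langlands quotient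
the irreducible principal series `π(1, (β′_v μ₁⁻¹)⁻¹)` itself (the display `Bump1997_Thm4_5_1`: the character
`β′_v μ₁⁻¹` is unitary, so its value is neither `q_v` nor `q_v⁻¹` — `unit_ne_N`), and the twist rule gives the
Satake parameters `(μ₂, β′_v⁻¹ μ₁ μ₂)` — TIER5 §N4.1.9 (A′-2) (the central character is `ω_{π_v} = μ₁ μ₂²
β′_v⁻¹`, so the second parameter is `ω_{π_v} μ₂⁻¹`).

`satake_split`: at every prime `𝔓` of `E` above a SPLIT place `v ∉ S`, the Satake parameters of
`BC(π_v) ⊗ χ_{V,v}` are `{η₁′(𝔓), η₂′(𝔓)}` — at `𝔓₁`: `(μ₂ χ₁, ω μ₂⁻¹ χ₁)` against `(η₂′, η₁′)(𝔓₁) =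
(γ_D(𝔓₁) χ₁, ω̃(𝔓₁) γ_D(𝔓₁)⁻¹ χ₁)`, at `𝔓₂`: `(μ₂⁻¹ χ₂, ω⁻¹ μ₂ χ₂)` against `(γ_D(𝔓₂) χ₂, ω̃(𝔓₂) γ_D(𝔓₂)⁻¹ χ₂)` with
`γ_D(𝔓₂) = γ_D(𝔓₁)⁻¹`, `ω̃(𝔓₂) = ω⁻¹` — equal as unordered pairs exactly when `γ_D(𝔓₁) = μ₂`: the residual
binder `hκ` = (A″κ) of TIER5 §N4.1.9 (c6) / §N4.1.10 («`μ₂` is the `w`-component of the global character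
`γ_D`»; route-1's Lemma A′-4 closes it in prose over Rao / [MVW] / GR91 — not formalised here: class AD, the
ONE [A]-row left of N4.1).

`N41_placement_split`: the unramified identity `hunr` with BOTH halves of (P7) discharged modulo `hκ` — the
displays LR §7 / §10, Bump (5.22), Harris II (2.2.5)(b), Rogawski §11.4, Mínguez Thm 1 (2), Bump Thm 4.5.1 by
name, the dichotomy `hdich`, the residual `hκ`.  `#print axioms` = {propext, Classical.choice, Quot.sound}.

§8(d): uses an L-value-free non-vanishing device: NO.
-/

namespace Summit.Ventures.HodgeRepro2.T6
namespace N41Place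

variable {ι : Type*} {D : DoublingLDatum ι} {Pl : PlacementDatum D} {In : InertDatum Pl}

/-- `β′_v μ₁⁻¹` is unitary (`β′_v` and `μ₁` are). -/
theorem norm_βv_mul_inv_μ₁ (Sp : SplitDatum In) (v : ι) (hv : Sp.splitPlace v) (hS : v ∉ D.S) :
    ‖((Sp.βv v * (Sp.μ₁ v)⁻¹ : ℂˣ) : ℂ)‖ = 1 := by
  rw [Units.val_mul, norm_mul, Sp.βv_unit v hv hS, Units.val_inv_eq_inv_val, norm_inv, Sp.μ₁_unit v hv hS]
  norm_num

/-- A complex number of modulus `1` is neither `q` nor `q⁻¹` for a real `q > 1`. -/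
theorem unit_ne_N {x : ℂ} (hx : ‖x‖ = 1) {q : ℝ} (hq : 1 < q) : x ≠ (q : ℂ) ∧ x ≠ ((q : ℂ))⁻¹ := by
  constructor
  · intro h
    have : ‖x‖ = q := by
      rw [h, Complex.norm_real, Real.norm_eq_abs, abs_of_pos (by linarith)]
    linarith
  · intro h
    have : ‖x‖ = q⁻¹ := by
      rw [h, norm_inv, Complex.norm_real, Real.norm_eq_abs, abs_of_pos (by linarith)]
    have hq' : q⁻¹ < 1 := inv_lt_one_of_one_lt₀ hq
    linarith

/-- **The Satake parameters of `π_v` at a split place** (TIER5 §N4.1.9 (A′-2)): from Mínguez's Théorème 1 (2)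
(`hM`) and Bump's Theorem 4.5.1 (`hB`), `π_v = I(μ₂, β′_v⁻¹ μ₁ μ₂)`. -/
theorem π_eq_psF {Sp : SplitDatum In} (L : SplitLQ Sp) (hM : Hyp.Minguez2008_Thm1_2_LQ L)
    (hB : Hyp.Bump1997_Thm4_5_1 L) (v : ι) (hv : Sp.splitPlace v) (hS : v ∉ D.S) :
    In.π v = Sp.psF v (Sp.μ₂ v) ((Sp.βv v)⁻¹ * Sp.μ₁ v * Sp.μ₂ v) := by
  -- Bump's condition for `ℬ(1, (β′_v μ₁⁻¹)⁻¹)`: `1 · ((β′_v μ₁⁻¹)⁻¹)⁻¹ = β′_v μ₁⁻¹` has modulus `1`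
  have hu := norm_βv_mul_inv_μ₁ Sp v hv hS
  have hne := unit_ne_N hu (Pl.one_lt_N (Sp.p₁ v))
  have hB' := hB v hv 1 (Sp.βv v * (Sp.μ₁ v)⁻¹)⁻¹ (by simpa using hne.1) (by simpa using hne.2)
  rw [Sp.π_Θ v hv hS (In.thetaLift_all v), Sp.Θ_eq v hv hS, hM v hv, hB', Sp.twistF_ps, one_mul, mul_inv,
    inv_inv]

/-- **The Satake identity at the split places.**  From Mínguez's Théorème 1 (2) (`hM`) and Bump's Theorem 4.5.1
(`hB`) over the split datum `Sp` with its Langlands-quotient carrier `L`, and the residual `hκ` (= (A″κ)): at every split prime `𝔓` off `S`, `(α 𝔓, β 𝔓)` is `(η₁′(𝔓), η₂′(𝔓))` up to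
order. -/
theorem satake_split {Sp : SplitDatum In} (L : SplitLQ Sp) (hM : Hyp.Minguez2008_Thm1_2_LQ L)
    (hB : Hyp.Bump1997_Thm4_5_1 L)
    (hκ : ∀ v, Sp.splitPlace v → v ∉ D.S → In.γD (Sp.p₁ v) = Sp.μ₂ v) :
    ∀ 𝔓, Sp.splitPlace (Pl.b 𝔓) → Pl.b 𝔓 ∉ D.S →
      (Pl.α 𝔓 = Pl.η₁ 𝔓 ∧ Pl.β 𝔓 = Pl.η₂ 𝔓) ∨ (Pl.α 𝔓 = Pl.η₂ 𝔓 ∧ Pl.β 𝔓 = Pl.η₁ 𝔓) := by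
  intro 𝔓 hs hS
  obtain ⟨v, hv⟩ : ∃ v, Pl.b 𝔓 = v := ⟨_, rfl⟩
  have hs' : Sp.splitPlace v := by rw [← hv]; exact hs
  have hS' : v ∉ D.S := by rw [← hv]; exact hS
  -- the Satake parameters of `π_v` and its central character
  have hπ := π_eq_psF L hM hB v hs' hS'
  set a := Sp.μ₂ v with ha
  set b := (Sp.βv v)⁻¹ * Sp.μ₁ v * Sp.μ₂ v with hb
  have hω : Sp.ωc v (In.π v) = a * b := by rw [hπ, Sp.ωc_ps]
  have hγ : In.γD (Sp.p₁ v) = a := hκ v hs' hS'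
  rcases Sp.fiber_split 𝔓 hs with h₁ | h₂
  · -- `𝔓 = 𝔓₁`: `BC(π_v) ⊗ χ_V` has parameters `(a χ₁, b χ₁)`, `(η₂′, η₁′)(𝔓₁) = (a χ₁, b χ₁)`
    rw [hv] at h₁
    subst h₁
    have hBC : Pl.BCχ (Sp.p₁ v) =
        Pl.ps (Sp.p₁ v) (a * In.ξV (Sp.p₁ v)) (b * In.ξV (Sp.p₁ v)) := by
      rw [Sp.BCχ_p₁ v hs' hS', hπ, Sp.ι₁_ps, In.twist_ps]
    have hαβ := In.ps_inj _ _ _ _ _ ((Pl.BCχ_ps _ hS).symm.trans hBC)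
    have hη₂ : Pl.η₂ (Sp.p₁ v) = a * In.ξV (Sp.p₁ v) := by
      rw [Sp.η₂_def _ hs hS, hγ]
    have hη₁ : Pl.η₁ (Sp.p₁ v) = b * In.ξV (Sp.p₁ v) := by
      rw [Sp.η₁_def _ hs hS, Sp.ωt_p₁ v hs' hS', hω, hγ, mul_comm a b, mul_inv_cancel_right]
    rw [hη₁, hη₂]
    rcases hαβ with ⟨h₁, h₂⟩ | ⟨h₁, h₂⟩
    · exact Or.inr ⟨h₁, h₂⟩
    · exact Or.inl ⟨h₁, h₂⟩
  · -- `𝔓 = 𝔓₂`: `BC(π_v) ⊗ χ_V` has parameters `(a⁻¹ χ₂, b⁻¹ χ₂)`, `(η₂′, η₁′)(𝔓₂) = (a⁻¹ χ₂, b⁻¹ χ₂)`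
    rw [hv] at h₂
    subst h₂
    have hBC : Pl.BCχ (Sp.p₂ v) =
        Pl.ps (Sp.p₂ v) (a⁻¹ * In.ξV (Sp.p₂ v)) (b⁻¹ * In.ξV (Sp.p₂ v)) := by
      rw [Sp.BCχ_p₂ v hs' hS', hπ, Sp.ι₂_ps, In.twist_ps]
    have hαβ := In.ps_inj _ _ _ _ _ ((Pl.BCχ_ps _ hS).symm.trans hBC)
    have hη₂ : Pl.η₂ (Sp.p₂ v) = a⁻¹ * In.ξV (Sp.p₂ v) := by
      rw [Sp.η₂_p₂ v hs' hS', hγ]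
    have hη₁ : Pl.η₁ (Sp.p₂ v) = b⁻¹ * In.ξV (Sp.p₂ v) := by
      rw [Sp.η₁_def _ hs hS, Sp.ωt_p₂ v hs' hS', hω, Sp.γD_p₂ v hs' hS', hγ, inv_inv, mul_inv,
        mul_comm a⁻¹ b⁻¹, inv_mul_cancel_right]
    rw [hη₁, hη₂]
    rcases hαβ with ⟨h₁, h₂⟩ | ⟨h₁, h₂⟩
    · exact Or.inr ⟨h₁, h₂⟩
    · exact Or.inl ⟨h₁, h₂⟩

/-- **The unramified identity `hunr` with both halves of (P7) discharged modulo (A″κ).**  Binders: the displays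
LR §7 / §10, Bump (5.22), Harris II (2.2.5)(b), Rogawski §11.4, Mínguez Thm 1 (2), Bump Thm 4.5.1 BY NAME; the
dichotomy `hdich`; and the residual `hκ`. -/
theorem N41_placement_split (D : DoublingLDatum ι) (Pl : PlacementDatum D) (In : InertDatum Pl)
    (Sp : SplitDatum In) (L : SplitLQ Sp)
    (hLR7 : Hyp.LapidRallis2005_Sec7_Unramified D Pl) (hB : Hyp.Bump1997_5_22 Pl)
    (hHa : Hyp.HarrisII2007_Prop2_2_5_b In) (hRo : Hyp.Rogawski1990_Sec11_4_BC In)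
    (hM : Hyp.Minguez2008_Thm1_2_LQ L) (hB451 : Hyp.Bump1997_Thm4_5_1 L)
    (hdich : ∀ 𝔓, Pl.b 𝔓 ∉ D.S → In.inert 𝔓 ∨ Sp.splitPlace (Pl.b 𝔓))
    -- [residual: AD — (A″κ) of TIER5 §N4.1.9 (c6) / §N4.1.10: at a split `v ∉ S` the `GL₂`-side twist `μ₂` of the
    -- datum's Weil representation relative to Mínguez's model is the `𝔓₁`-component of the global character
    -- `γ_D` (route-1's Lemma A′-4 in prose over Rao Thm 5.3 / [MVW] Ch. 2 / GR91 (3.1.2)–(3.1.3); the ONE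
    -- [A]-row left of N4.1)]
    (hκ : ∀ v, Sp.splitPlace v → v ∉ D.S → In.γD (Sp.p₁ v) = Sp.μ₂ v) :
    ∀ v ∉ D.S, ∀ s : ℂ, D.Lv v s = D.g₁ v s * D.g₂ v s :=
  N41_placement_inert D Pl In (fun 𝔓 => Sp.splitPlace (Pl.b 𝔓)) hLR7 hB hHa hRo hdich
    (satake_split L hM hB451 hκ)

end N41Place
end Summit.Ventures.HodgeRepro2.T6
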